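import Literature.MathematicalPhysics.QuantumLattice.LatticeGaugeDLRFreeEnergyProofs
import Literature.MathematicalPhysics.QuantumLattice.LatticeGaugeDLRGibbsProofs
import HarnessLib

/-!
# E5: the mean boundary Wilson action of a box in a translation-invariant state

Helper (E5 of the "energy programme") of crux `FibreToTorus` (stmt-QuantumFields-16244), line
`Sketch`, route `ContractibleFibre`: a step of "pressure differentiable at `β` ⇒ all
translation-invariant DLR states have the same mean action density" (Friedli–Velenik 2017
Prop. 6.91 / Lebowitz 1977 §3, transcribed to lattice gauge theory; template for the Ising model:
`sum_edgesTouching_integral_bondSpin_le` in `Literature/Probability/LatticeModels/GibbsEnergyBounds`).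

For a translation-invariant probability measure `μ` on lattice gauge configurations and the edge
box `Λ_{n+1} := halfOpenBox d (n+1) ×ˢ univ`, the `μ`-mean of the boundary Wilson action
`S_{Λ_{n+1}}(U) = ∑_{p ∩ Λ_{n+1} ≠ ∅} (N - Re tr ρ(U_p))` equals `n^d · e(μ)`, where
`e(μ) := ∑_{planes q} (N - ∫ Re tr ρ(U_{(0;q)}) dμ)` is the mean plaquette energy per site, up to
an error of at most `N + M` times the number of plaquettes touching `Λ_{n+1}` whose base point is
not in `halfOpenBox d n` (`M` a bound on `|Re tr ρ|`).

Proof: `∫ S dμ = ∑_p (N - ∫ Re tr ρ(U_p) dμ)` (a finite sum of bounded continuous observables);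
split the plaquettes touching `Λ_{n+1}` into `B := halfOpenBox d n ×ˢ univ` (a subset, by
hypothesis) and the rest (`Finset.sum_sdiff`); on `B`, translation invariance
(`Re tr ρ(U_{(x;q)}) = Re tr ρ((θ_{-x} U)_{(0;q)})` and `μ ∘ θ_{-x}⁻¹ = μ`) makes every term equal to
the term at the origin, giving `#(halfOpenBox d n) · e(μ) = n^d · e(μ)`; each remaining term is
bounded by `N + M` in absolute value.
-/

noncomputable section

open MeasureTheory Filter Topology Finset
open Literature.Probability.LatticeModels (Site halfOpenBox glueWith)
open Literature.MathematicalPhysics.QuantumLattice (LGConfig ZdEdge ZdPlaquette plaquetteObs plaquetteEdges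
  plaquettesTouching wilsonBoundaryAction ymSpecification ymGibbsMeasures IsZdTranslationInvariant
  freeEnergyDensity configShift)
open Literature.MathematicalPhysics.QuantumFieldTheory (haarProbability zdHaar)

namespace Summit.QuantumFields.YangMills.Theorems.FibreToTorus

section Helpers

variable {d N : ℕ} {G : Type*} [Group G] (ρ : G →* Matrix (Fin N) (Fin N) ℂ)

/-- Plaquette observables of a translated configuration:
`Re tr ρ((θ_v U)_{(x;i,j)}) = Re tr ρ(U_{(x-v;i,j)})` (`configShift v U e = U (e.1 - v, e.2)`;
Georgii 2011 (5.3)). [folklore] -/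
theorem energyE5_plaquetteObs_configShift [MeasurableSpace G] (v x : Site d) (i j : Fin d)
    (U : LGConfig d G) :
    plaquetteObs ρ x i j (configShift v U) = plaquetteObs ρ (x - v) i j U := by
  simp only [plaquetteObs, Literature.MathematicalPhysics.QuantumLattice.plaquetteHolonomyZd,
    Literature.MathematicalPhysics.QuantumLattice.configShift_apply, add_sub_right_comm]

/-- The plaquette observable inherits the trace bound of the representation:
`|Re tr ρ(U_p)| ≤ M` whenever `|Re tr ρ(g)| ≤ M` for all `g ∈ G`. [folklore] -/
theorem energyE5_abs_plaquetteObs_le {M : ℝ} (hM : ∀ g : G, |(ρ g).trace.re| ≤ M) (x : Site d)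
    (i j : Fin d) (U : LGConfig d G) : |plaquetteObs ρ x i j U| ≤ M :=
  hM _

variable [TopologicalSpace G] [IsTopologicalGroup G] [MeasurableSpace G] [BorelSpace G]
  [SecondCountableTopology G]

/-- A bounded continuous plaquette observable is integrable for every finite measure on
configurations (continuity of `ρ`, second countability of `G`). [folklore] -/
theorem energyE5_integrable_plaquetteObs (hρ : Continuous ρ) {M : ℝ}
    (hM : ∀ g : G, |(ρ g).trace.re| ≤ M) (μ : Measure (LGConfig d G)) [IsFiniteMeasure μ]
    (x : Site d) (i j : Fin d) : Integrable (plaquetteObs ρ x i j) μ :=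
  Integrable.of_bound
    (Literature.MathematicalPhysics.QuantumLattice.measurable_plaquetteObs ρ hρ x i
      j).aestronglyMeasurable M
    (ae_of_all _ fun U => by
      rw [Real.norm_eq_abs]
      exact energyE5_abs_plaquetteObs_le ρ hM x i j U)

omit [TopologicalSpace G] [IsTopologicalGroup G] [BorelSpace G] [SecondCountableTopology G] in
/-- In a translation-invariant state the mean plaquette observable does not depend on the base
point: `∫ Re tr ρ(U_{(x;i,j)}) dμ = ∫ Re tr ρ(U_{(0;i,j)}) dμ`, by the change of variables
`U ↦ θ_{-x} U` (Georgii 2011 (5.4)). [folklore] -/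
theorem energyE5_integral_plaquetteObs_eq {μ : Measure (LGConfig d G)}
    (hμ : IsZdTranslationInvariant μ) (x : Site d) (i j : Fin d) :
    ∫ U, plaquetteObs ρ x i j U ∂μ = ∫ U, plaquetteObs ρ 0 i j U ∂μ := by
  calc ∫ U, plaquetteObs ρ x i j U ∂μ
      = ∫ U, plaquetteObs ρ 0 i j (configShift (-x) U) ∂μ := by
        simp_rw [energyE5_plaquetteObs_configShift, zero_sub, neg_neg]
    _ = ∫ U, plaquetteObs ρ 0 i j U ∂(μ.map (configShift (-x))) :=
        (integral_map_equiv _ _).symm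
    _ = ∫ U, plaquetteObs ρ 0 i j U ∂μ := by rw [hμ (-x)]

omit [TopologicalSpace G] [IsTopologicalGroup G] [BorelSpace G] [SecondCountableTopology G] in
/-- The mean of one plaquette energy term on a probability space is bounded:
`|N - ∫ Re tr ρ(U_p) dμ| ≤ N + M`. [folklore] -/
theorem energyE5_abs_sub_integral_plaquetteObs_le {M : ℝ} (hM : ∀ g : G, |(ρ g).trace.re| ≤ M)
    (μ : Measure (LGConfig d G)) [IsProbabilityMeasure μ] (x : Site d) (i j : Fin d) :
    |(N : ℝ) - ∫ U, plaquetteObs ρ x i j U ∂μ| ≤ N + M := by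
  have h1 : |∫ U, plaquetteObs ρ x i j U ∂μ| ≤ M := by
    have h := norm_integral_le_of_norm_le_const (μ := μ) (f := plaquetteObs ρ x i j) (C := M)
      (ae_of_all _ fun U => by rw [Real.norm_eq_abs]; exact hM _)
    simpa [Real.norm_eq_abs] using h
  calc |(N : ℝ) - ∫ U, plaquetteObs ρ x i j U ∂μ|
      ≤ |(N : ℝ)| + |∫ U, plaquetteObs ρ x i j U ∂μ| := abs_sub _ _
    _ ≤ N + M := by rw [Nat.abs_cast]; exact add_le_add le_rfl h1

end Helpers

/-- **E5: the mean boundary Wilson action of a box in a translation-invariant state.** For a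
continuous representation `ρ` with `|Re tr ρ| ≤ M`, a translation-invariant probability measure
`μ` and the edge box `Λ_{n+1} = halfOpenBox d (n+1) ×ˢ univ`,
`|∫ S_{Λ_{n+1}} dμ - n^d · ∑_q (N - ∫ Re tr ρ(U_{(0;q)}) dμ)| ≤ (N + M) · #(P(Λ_{n+1}) \ B)`,
`B = halfOpenBox d n ×ˢ univ ⊆ P(Λ_{n+1})` the plaquettes based in the smaller box: the terms over
`B` are all equal to the term at the origin by translation invariance, and each of the remaining
`#(P(Λ_{n+1}) \ B)` terms is at most `N + M` in absolute value (Friedli–Velenik 2017 Prop. 6.91 /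
Lebowitz 1977 §3, lattice-gauge transcription). [folklore] -/
theorem energy_integral_wilsonBoundaryAction_box : ∀ (d N : ℕ) (G : Type) [Group G] [TopologicalSpace G] [IsTopologicalGroup G] [CompactSpace G] [MeasurableSpace G] [BorelSpace G] [SecondCountableTopology G] (ρ : G →* Matrix (Fin N) (Fin N) ℂ), Continuous ρ → ∀ (M : ℝ), (∀ g : G, |(ρ g).trace.re| ≤ M) → ∀ (μ : MeasureTheory.Measure (LGConfig d G)), MeasureTheory.IsProbabilityMeasure μ → IsZdTranslationInvariant μ → ∀ n : ℕ, (halfOpenBox d n ×ˢ (Finset.univ : Finset {q : Fin d × Fin d // q.1 < q.2}) : Finset (ZdPlaquette d)) ⊆ plaquettesTouching (halfOpenBox d (n + 1) ×ˢ (Finset.univ : Finset (Fin d))) → |(∫ U, wilsonBoundaryAction ρ (halfOpenBox d (n + 1) ×ˢ (Finset.univ : Finset (Fin d))) U ∂μ) - ((n : ℝ) ^ d) * ∑ q : {q : Fin d × Fin d // q.1 < q.2}, ((N : ℝ) - ∫ U, plaquetteObs ρ 0 q.1.1 q.1.2 U ∂μ)| ≤ (N + M) * #(plaquettesTouching (halfOpenBox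 d (n + 1) ×ˢ (Finset.univ : Finset (Fin d))) \ halfOpenBox d n ×ˢ (Finset.univ : Finset {q : Fin d × Fin d // q.1 < q.2})) := by
  intro d N G _ _ _ _ _ _ _ ρ hρ M hM μ hμP hμT n hsub
  set PT := plaquettesTouching (halfOpenBox d (n + 1) ×ˢ (Finset.univ : Finset (Fin d))) with hPT
  set B : Finset (ZdPlaquette d) :=
    halfOpenBox d n ×ˢ (Finset.univ : Finset {q : Fin d × Fin d // q.1 < q.2}) with hB
  set a : ZdPlaquette d → ℝ := fun p => (N : ℝ) - ∫ U, plaquetteObs ρ p.1 p.2.1.1 p.2.1.2 U ∂μ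
    with ha
  -- the mean action is the sum of the mean plaquette energies
  have hint : ∫ U, wilsonBoundaryAction ρ (halfOpenBox d (n + 1) ×ˢ (Finset.univ : Finset (Fin d)))
      U ∂μ = ∑ p ∈ PT, a p := by
    simp only [wilsonBoundaryAction]
    rw [integral_finsetSum]
    · refine Finset.sum_congr rfl fun p _ => ?_
      rw [integral_sub (integrable_const _) (energyE5_integrable_plaquetteObs ρ hρ hM μ _ _ _),
        integral_const, smul_eq_mul, probReal_univ, one_mul]
    · exact fun p _ => (integrable_const _).sub (energyE5_integrable_plaquetteObs ρ hρ hM μ _ _ _)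
  -- the bulk terms: translation invariance
  have hBsum : ∑ p ∈ B, a p = ((n : ℝ) ^ d) *
      ∑ q : {q : Fin d × Fin d // q.1 < q.2}, ((N : ℝ) - ∫ U, plaquetteObs ρ 0 q.1.1 q.1.2 U ∂μ) := by
    rw [hB, Finset.sum_product]
    have h : ∀ x ∈ halfOpenBox d n, ∑ q : {q : Fin d × Fin d // q.1 < q.2}, a (x, q) =
        ∑ q : {q : Fin d × Fin d // q.1 < q.2},
          ((N : ℝ) - ∫ U, plaquetteObs ρ 0 q.1.1 q.1.2 U ∂μ) := fun x _ =>
      Finset.sum_congr rfl fun q _ => by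
        simp only [ha, energyE5_integral_plaquetteObs_eq ρ hμT x]
    rw [Finset.sum_congr rfl h, Finset.sum_const,
      Literature.Probability.LatticeModels.card_halfOpenBox, nsmul_eq_mul, Nat.cast_pow]
  have hsplit := Finset.sum_sdiff hsub (f := a)
  rw [hint, ← hsplit, hBsum, add_sub_cancel_right]
  -- the boundary terms
  calc |∑ p ∈ PT \ B, a p| ≤ ∑ p ∈ PT \ B, |a p| := Finset.abs_sum_le_sum_abs _ _
    _ ≤ ∑ _p ∈ PT \ B, ((N : ℝ) + M) :=
        Finset.sum_le_sum fun p _ => energyE5_abs_sub_integral_plaquetteObs_le ρ hM μ _ _ _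
    _ = (N + M) * #(PT \ B) := by rw [Finset.sum_const, nsmul_eq_mul, mul_comm]

end Summit.QuantumFields.YangMills.Theorems.FibreToTorus

end
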